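import Mathlib
import Summits.KontsevichZagierPeriods.Zeta5Search.UniversalDigitW
import Summits.KontsevichZagierPeriods.Zeta5Search.RecordCellAReflect
import HarnessLib

/-!
# ζ(5) search — the universal first digit of the constant-term piece: `V_x = (−p)^{E_x}(ĝ_q·v̂_x + O(p))` (gen-2 g9's U-V)

Cell `pub-zeta5` (HONEST FRAMING: systematic search; no irrationality claim unless certified), P1 prover seat
generation 5.  gen-2 g9 (REPORT-gen2-g9 §1.2, statement `VDigit` of the staged `G9UniversalDigit.lean`, exact check 118,807
classes): for a residue class `x` with a pole `q`, **`v_p(V_x − (−p)^{E_x}·ĝ_q·v̂_x) ≥ E_x + 1`** with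
`v̂_x = Σ_{poles s} Σ_{σ ≤ n_s} (−1)^σ ρ_{s,σ} H^{(σ)}_{⌊s/p⌋}` (`vHat`).  Proof: split every harmonic sum at the multiples of `p`,
`H_s^{(σ)} = p^{−σ} H^{(σ)}_{⌊s/p⌋} + (p-integral)` (`padicNorm_harm_sub_level_le_one`, by induction on `s`), Theorem B for each
`c_{σ−1,s}` (`leadingDigit_holds`), Theorem A for the size of `c_{σ−1,s}` (`clusterBound_holds`), `ĝ_s ≡ ĝ_q` (G1) and the
integrality of `ρ` and of `H_{⌊s/p⌋}` (`⌊s/p⌋ < p` in the window).  Proved with literally gen-2's statement body (`vDigit`);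
`vHat` is defined with gen-2's body.  With `wDigit` this is the complete first-digit input of the `W`-row form of THEOREM LB♯♯.
`p`-adic valuations of rational numbers; nothing about irrationality.
-/

noncomputable section

open Finset PowerSeries

namespace Summit.KontsevichZagierPeriods.Zeta5Search.CellA

open Summit.KontsevichZagierPeriods.Zeta5Search.DualSeries (InBox)
open Summit.KontsevichZagierPeriods.Zeta5Search.WedgeDictionary (IsPFData pfData)
open Summit.KontsevichZagierPeriods.Zeta5Search.CasoratianValuation (InPolytope)
open Summit.KontsevichZagierPeriods.Zeta5Search.ClusterValuation
open Summit.KontsevichZagierPeriods.Zeta5Search.PadicSeries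
open Literature.NumberTheory.Transcendental.BallRivoal (harm)

variable {p : ℕ} [hp : Fact p.Prime]

/-- `v̂_x := Σ_{poles q ∈ x} Σ_{σ=1}^{n_q} (−1)^σ ρ_{q,σ} H^{(σ)}_{ℓ_q}` (gen-2 g9's body; `ℓ_q = q / p`). -/
def vHat (b : ℕ → ℤ) (p x : ℕ) : ℚ :=
  ∑ q ∈ classPoles b p x, ∑ σ ∈ Icc 1 (-netExp b q).toNat, (-1 : ℚ) ^ σ * classRho b p q σ * harm σ (q / p)

/-! ### Harmonic sums split at the multiples of `p` -/

omit hp in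
/-- `H_{s+1}^{(σ)} = H_s^{(σ)} + (s+1)^{−σ}`. -/
theorem harm_succ (σ s : ℕ) : harm σ (s + 1) = harm σ s + 1 / ((s : ℚ) + 1) ^ σ := by
  rw [harm, sum_range_succ, harm]

/-- **`H_s^{(σ)} − p^{−σ}·H^{(σ)}_{⌊s/p⌋}` is `p`-integral** (the multiples `k = mp` of `p` contribute exactly `p^{−σ}m^{−σ}`). -/
theorem padicNorm_harm_sub_level_le_one (σ s : ℕ) :
    padicNorm p (harm σ s - harm σ (s / p) / (p : ℚ) ^ σ) ≤ 1 := by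
  have hp0 : (p : ℚ) ≠ 0 := Nat.cast_ne_zero.2 hp.out.ne_zero
  induction s with
  | zero => simp [harm]
  | succ s ih =>
    rw [Nat.succ_div, harm_succ]
    by_cases hdvd : p ∣ s + 1
    · rw [if_pos hdvd, harm_succ]
      obtain ⟨m, hm⟩ := hdvd
      have hm0 : 0 < m := by
        rcases Nat.eq_zero_or_pos m with rfl | h
        · omega
        · exact h
      have hdiv : (s / p : ℕ) = m - 1 := by
        have : s = p * (m - 1) + (p - 1) := by
          have := hp.out.one_lt
          zify [this.le, hm0] at hm ⊢
          linarith
        rw [this, Nat.mul_add_div hp.out.pos, Nat.div_eq_of_lt (by have := hp.out.one_lt; omega)]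
        omega
      have e : harm σ s + 1 / ((s : ℚ) + 1) ^ σ - (harm σ (s / p) + 1 / (((s / p : ℕ) : ℚ) + 1) ^ σ) / (p : ℚ) ^ σ =
          harm σ s - harm σ (s / p) / (p : ℚ) ^ σ := by
        have hs1 : ((s : ℚ) + 1) = (p : ℚ) * m := by exact_mod_cast hm
        have hm1 : (((s / p : ℕ) : ℚ) + 1) = m := by
          rw [hdiv]; push_cast [Nat.cast_sub hm0]; ring
        rw [hs1, hm1, mul_pow]
        field_simp
        ring
      rw [e]; exact ih
    · rw [if_neg hdvd, add_zero]
      have e : harm σ s + 1 / ((s : ℚ) + 1) ^ σ - harm σ (s / p) / (p : ℚ) ^ σ =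
          (harm σ s - harm σ (s / p) / (p : ℚ) ^ σ) + 1 / ((s : ℚ) + 1) ^ σ := by ring
      rw [e]
      refine (padicNorm.nonarchimedean (p := p)).trans (max_le ih ?_)
      have := padicNorm_inv_pow_le_one (p := p) hdvd σ
      push_cast at this
      exact this

/-! ### U-V -/

omit hp in
/-- Reindexing `Σ_{σ ∈ [1,n]}` as `Σ_{o<6} [o+1 ≤ n]` for `n ≤ 6`. -/
theorem sum_Icc_one_eq_sum_range_six {n : ℕ} (hn : n ≤ 6) (f : ℕ → ℚ) :
    ∑ σ ∈ Icc 1 n, f σ = ∑ o ∈ range 6, if o + 1 ≤ n then f (o + 1) else 0 := by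
  interval_cases n <;> simp [sum_range_succ, Finset.sum_Icc_succ_top, Icc_self]

/-- **U-V (gen-2 g9, `VDigit`)**: the first digit of the constant-term piece of a class is `ĝ_q·v̂_x`. -/
theorem vDigit : ∀ (b : ℕ → ℤ) (p x q : ℕ), InPolytope b → p.Prime → 5 ≤ p → (b 0 + 2 : ℤ) < (p : ℤ) ^ 2 → x < p →
    q ∈ classSet b p x → netExp b q < 0 →
      classV b p x - (-(p : ℚ)) ^ classExp b p x * gHat b p q * vHat b p x ≠ 0 →
        classExp b p x + 1 ≤ padicValRat p (classV b p x - (-(p : ℚ)) ^ classExp b p x * gHat b p q * vHat b p x) := by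
  intro b p x q hb hprime hp5 hwin hx hq hqpole hne
  haveI : Fact p.Prime := ⟨hprime⟩
  obtain ⟨hbox, -, -, hn⟩ := thmA_data b hb hwin
  have h0 : 0 ≤ b 0 := hbox.1
  have hp2 : p ≠ 2 := by omega
  have hp0 : (p : ℚ) ≠ 0 := Nat.cast_ne_zero.2 hprime.ne_zero
  have hp' : (-(p : ℚ)) ≠ 0 := neg_ne_zero.2 hp0
  set E := classExp b p x with hE
  -- rewrite v̂ as a double sum over the whole class and `o < 6`
  have hv : vHat b p x = ∑ s ∈ classSet b p x, ∑ o ∈ range 6,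
      (if (o : ℤ) + 1 ≤ -netExp b s then (-1 : ℚ) ^ (o + 1) * classRho b p s (o + 1) * harm (o + 1) (s / p) else 0) := by
    rw [vHat, classPoles, sum_filter]
    refine sum_congr rfl fun s _ => ?_
    have h6 : (-netExp b s).toNat ≤ 6 := by
      have := blockCount_le b s; unfold netExp; split_ifs <;> omega
    split_ifs with hpole
    · rw [sum_Icc_one_eq_sum_range_six h6]
      refine sum_congr rfl fun o _ => ?_
      have : (o + 1 ≤ (-netExp b s).toNat) ↔ ((o : ℤ) + 1 ≤ -netExp b s) := by omega
      simp only [this]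
    · refine (sum_eq_zero fun o _ => ?_).symm
      rw [if_neg (by omega)]
  have hsplit : classV b p x - (-(p : ℚ)) ^ E * gHat b p q * vHat b p x =
      ∑ s ∈ classSet b p x, ∑ o ∈ range 6, (pfData b o s * harm (o + 1) s - (-(p : ℚ)) ^ E * gHat b p q *
        (if (o : ℤ) + 1 ≤ -netExp b s then (-1 : ℚ) ^ (o + 1) * classRho b p s (o + 1) * harm (o + 1) (s / p) else 0)) := by
    rw [hv, classV, mul_sum, ← sum_sub_distrib]
    refine sum_congr rfl fun s _ => ?_
    rw [mul_sum, ← sum_sub_distrib]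
  -- common norms
  have hpowE : padicNorm p ((-(p : ℚ)) ^ E) = (p : ℚ) ^ (-E) := by
    rw [padicNorm.eq_zpow_of_nonzero (zpow_ne_zero _ hp'), padicValRat.zpow, padicValRat.neg,
      padicValRat.self hprime.one_lt, mul_one]
  have hgq : padicNorm p (gHat b p q) ≤ 1 := by
    by_cases h0' : gHat b p q = 0
    · rw [h0', padicNorm.zero]; exact zero_le_one
    · have := (gHat_classCongr b p x q q hb hprime hp5 hx hq hq).1
      rw [padicNorm.eq_zpow_of_nonzero h0', this]; simp
  -- termwise bound `p^{-(E+1)}`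
  have hterm : ∀ s ∈ classSet b p x, ∀ o ∈ range 6,
      padicNorm p (pfData b o s * harm (o + 1) s - (-(p : ℚ)) ^ E * gHat b p q *
        (if (o : ℤ) + 1 ≤ -netExp b s then (-1 : ℚ) ^ (o + 1) * classRho b p s (o + 1) * harm (o + 1) (s / p) else 0))
        ≤ (p : ℚ) ^ (-(E + 1)) := by
    intro s hs o ho
    have hsn : s ≤ (b 0).toNat := ((mem_classSet_iff b x s).1 hs).1
    have ho' := mem_range.1 ho
    by_cases hord : (o : ℤ) + 1 ≤ -netExp b s
    · rw [if_pos hord]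
      have hEs : classExp b p s = E := classExp_eq_of_mem hs
      set σ := o + 1 with hσ
      set c := pfData b o s with hc
      set gs := gHat b p s with hgs
      set ρ := classRho b p s σ with hρdef
      set Hs := harm σ s with hHs
      set Hl := harm σ (s / p) with hHl
      -- Theorem B and Theorem A on `c`
      have hB : padicNorm p (c - (-(p : ℚ)) ^ ((σ : ℤ) + E) * gs * ρ) ≤ (p : ℚ) ^ (-((σ : ℤ) + E + 1)) := by
        refine padicNorm_le_of_val fun hne' => ?_
        have := leadingDigit_holds b p s σ hb hprime hp5 hwin hsn (by omega) (by omega)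
          (by rw [hEs, show σ - 1 = o by omega]; exact hne')
        rw [hEs, show σ - 1 = o by omega] at this
        linarith
      have hA : padicNorm p c ≤ (p : ℚ) ^ (-((σ : ℤ) + E)) := by
        refine padicNorm_le_of_val fun hne' => ?_
        have := clusterBound_holds b p s o hb hprime (by omega) hwin hsn ho' hne'
        rw [hEs] at this; push_cast [hσ]; linarith
      have hρ : padicNorm p ρ ≤ 1 := padicNorm_classRho_le_one b h0 hsn hn hp2 σ
      have hgsn : padicNorm p gs ≤ 1 := by
        by_cases h0' : gs = 0
        · rw [h0', padicNorm.zero]; exact zero_le_one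
        · have := (gHat_classCongr b p x s s hb hprime hp5 hx hs hs).1
          rw [padicNorm.eq_zpow_of_nonzero h0', this]; simp
      have hgg : padicNorm p (gs - gHat b p q) ≤ (p : ℚ) ^ (-(1 : ℤ)) := by
        refine padicNorm_le_of_val fun hne' => ?_
        exact (gHat_classCongr b p x s q hb hprime hp5 hx hs hq).2 (sub_ne_zero.1 hne')
      have hlp : s / p < p := Nat.div_lt_of_lt_mul (by nlinarith [hsn, hn])
      have hHl : padicNorm p Hl ≤ 1 := padicNorm_harm_le_one hlp σ
      have hHdiff : padicNorm p (Hs - Hl / (p : ℚ) ^ σ) ≤ 1 := padicNorm_harm_sub_level_le_one σ s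
      -- the algebra: term = c·(Hs − Hl/p^σ) + (−1)^σ(−p)^E (gs − gq) ρ Hl + (A/p^σ)·Hl
      have hzpow : (-(p : ℚ)) ^ ((σ : ℤ) + E) = (-1 : ℚ) ^ σ * (p : ℚ) ^ σ * (-(p : ℚ)) ^ E := by
        rw [zpow_add₀ hp', zpow_natCast, neg_pow]
      have e : c * Hs - (-(p : ℚ)) ^ E * gHat b p q * ((-1 : ℚ) ^ σ * ρ * Hl) =
          c * (Hs - Hl / (p : ℚ) ^ σ) + (-1 : ℚ) ^ σ * (-(p : ℚ)) ^ E * (gs - gHat b p q) * ρ * Hl +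
            (c - (-(p : ℚ)) ^ ((σ : ℤ) + E) * gs * ρ) / (p : ℚ) ^ σ * Hl := by
        rw [hzpow]; field_simp; ring
      rw [e]
      refine (padicNorm.nonarchimedean (p := p)).trans (max_le ((padicNorm.nonarchimedean (p := p)).trans (max_le ?_ ?_)) ?_)
      · rw [padicNorm.mul]
        calc padicNorm p c * padicNorm p (Hs - Hl / (p : ℚ) ^ σ) ≤ (p : ℚ) ^ (-((σ : ℤ) + E)) * 1 :=
              mul_le_mul hA hHdiff (padicNorm.nonneg _) (zpow_p_nonneg _)
          _ ≤ (p : ℚ) ^ (-(E + 1)) := by rw [mul_one]; exact zpow_le_zpow_right₀ one_le_p (by omega)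
      · rw [padicNorm.mul, padicNorm.mul, padicNorm.mul, padicNorm.mul, hpowE]
        have h1 : padicNorm p ((-1 : ℚ) ^ σ) = 1 := by
          rw [padicNorm_pow_eq, padicNorm.neg, padicNorm.one, one_pow]
        rw [h1, one_mul]
        calc (p : ℚ) ^ (-E) * padicNorm p (gs - gHat b p q) * padicNorm p ρ * padicNorm p Hl
            ≤ (p : ℚ) ^ (-E) * (p : ℚ) ^ (-(1 : ℤ)) * 1 * 1 := by
              refine mul_le_mul (mul_le_mul (mul_le_mul_of_nonneg_left hgg (zpow_p_nonneg _)) hρ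
                (padicNorm.nonneg _) (mul_nonneg (zpow_p_nonneg _) (zpow_p_nonneg _))) hHl (padicNorm.nonneg _) ?_
              exact mul_nonneg (mul_nonneg (zpow_p_nonneg _) (zpow_p_nonneg _)) zero_le_one
          _ = (p : ℚ) ^ (-(E + 1)) := by rw [mul_one, mul_one, ← zpow_add₀ hp0]; ring_nf
      · rw [padicNorm.mul, padicNorm.div, padicNorm_p_pow]
        calc padicNorm p (c - (-(p : ℚ)) ^ ((σ : ℤ) + E) * gs * ρ) / ((p : ℚ) ^ σ)⁻¹ * padicNorm p Hl
            ≤ (p : ℚ) ^ (-((σ : ℤ) + E + 1)) / ((p : ℚ) ^ σ)⁻¹ * 1 :=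
              mul_le_mul (div_le_div_of_nonneg_right hB (by positivity)) hHl (padicNorm.nonneg _)
                (div_nonneg (zpow_p_nonneg _) (by positivity))
          _ = (p : ℚ) ^ (-(E + 1)) := by
              rw [mul_one, div_inv_eq_mul, ← zpow_natCast, ← zpow_add₀ hp0]; ring_nf
    · rw [if_neg hord, mul_zero, sub_zero, pfData_eq_zero_of_order_le b hb hsn ho' (by omega), zero_mul, padicNorm.zero]
      exact zpow_p_nonneg _
  apply val_ge_of_padicNorm_le hne
  rw [hsplit]
  exact padicNorm.sum_le' (fun s hs => padicNorm.sum_le' (fun o ho => hterm s hs o ho) (zpow_p_nonneg _)) (zpow_p_nonneg _)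

end Summit.KontsevichZagierPeriods.Zeta5Search.CellA

end
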